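import Literature.AnabelianGeometry.AbsoluteAnabelian.AbsTopIII.GeometricCyclotomeModule
import Literature.AnabelianGeometry.AbsoluteAnabelian.AbsTopIII.DivisorSections
import HarnessLib

/-!
# [AbsTopIII] Prop. 1.6 (i), (iii), Prop. 1.8: Kummer classes with values in `H¹(Π_U, M_X)` (intrinsic)

Mochizuki, *Topics in Absolute Anabelian Geometry III*, §1, Prop. 1.6 pp. 34–35 and Prop. 1.8 p. 36
(manuscript pages, lit key `paper:url-5493eb38cbb7`): "let us write
`κ_U : Γ(U, 𝒪_U^×) → H¹(Π_U, M_X)` — where `M_X ≅ Ẑ(1)` is as in Proposition 1.4, (ii) — for the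
associated Kummer map"; "(i) The Kummer map `κ_U` is injective"; "(iii) Suppose that `U = X ∖ S`,
where `S ⊆ X(k)` is a finite subset. Then restricting cohomology classes of `Π_U` to the various
`I_x` [...] yields a natural exact sequence `1 → (k^×)^∧ → H¹(Π_U, M_X) → ⊕_{x ∈ S} Ẑ` [...]";
Prop. 1.8 (i), (ii) (characterization of NF-rational functions and NF-constants by restriction of
Kummer classes to decomposition groups of NF-points).

`CuspidalCyclotome.lean` typed these relative to a model whose Kummer map takes values in
`H¹(Π_U, M_X)` with `M_X` realised EXTRINSICALLY (through a cusp `x` and the presentation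
`U ⊆ U_x ⊆ X`).  With the INTRINSIC cyclotome `M_X = Hom(H²(Δ_X, Ẑ), Ẑ)` now a topological
`Π_X`-module (`GeometricCyclotomeModule.lean`: `cyclotomeModH1 r Λ = H¹(Π_U, M_X(Λ))`, REAL), this
file restates them over the canonical target:

* `IntrinsicKummerModel` — a `DivisorCurveModel` (rational points, `ord_x`) together with the
  Kummer maps `κ_U : Γ(U, 𝒪_U^×) → H¹(Π_U, M_X)` for cofinite opens `U ⊆ X`, `X` proper; here the
  regular units `Γ(U, 𝒪_U^×) = {f ∈ K_U^× | ord_x(f) = 0 ∀ x ∈ U}` are DEFINED from `ord`;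
* NAMED FACTS relative to `M`: `Prop_1_6_i` (injectivity of `κ_U` over a Kummer-faithful `k`),
  `Prop_1_6_iii_units` (a regular unit is constant iff all its restrictions to the cuspidal inertia
  groups vanish — the part of the exact sequence statable without the synchronizations),
  `Prop_1_8_i_units`, `Prop_1_8_ii_units` (as in `CuspidalCyclotome.lean`, for Kummer classes of
  units; the subgroup `P_U` itself needs the NATURAL synchronizations `I_z ⥲ M_X`, not typed).
-/

noncomputable section

open CategoryTheory
open scoped Classical

universe u

namespace Literature.AnabelianGeometry.AbsoluteAnabelian.AbsTopIII

namespace DivisorCurveModel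

variable (M : DivisorCurveModel.{u})

/-- **`Γ(U, 𝒪_U^×)`**, the regular units on `U`: rational functions with `ord_x = 0` at every closed
point `x` of `U` (DEFINED from the model's `ord`). [cite: MochizukiAbsTopIII2015, Prop 1.6 p.34] -/
def regularUnits (U : M.Curve) : Subgroup (M.FunctionField U)ˣ where
  carrier := {f | ∀ x : M.Point U, M.ord x f = 1}
  one_mem' := fun x => map_one _
  mul_mem' := fun {f g} hf hg x => by rw [map_mul, hf x, hg x, mul_one]
  inv_mem' := fun {f} hf x => by rw [map_inv, hf x, inv_one]

/-- Membership in `Γ(U, 𝒪_U^×)`. [cite: MochizukiAbsTopIII2015, Prop 1.6 p.34] -/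
theorem mem_regularUnits {U : M.Curve} (f : (M.FunctionField U)ˣ) :
    f ∈ M.regularUnits U ↔ ∀ x : M.Point U, M.ord x f = 1 :=
  Iff.rfl

/-- Constants are regular units iff they have order `0` everywhere (recorded form: the units of `k`
mapped into `K_U^×`). [cite: MochizukiAbsTopIII2015, Prop 1.6 p.34] -/
def IsConstantUnit {U : M.Curve} (f : (M.FunctionField U)ˣ) : Prop :=
  (f : M.FunctionField U) ∈ Set.range (algebraMap (M.base U) (M.FunctionField U))

end DivisorCurveModel

/-- A `DivisorCurveModel` together with "the associated Kummer map
`κ_U : Γ(U, 𝒪_U^×) → H¹(Π_U, M_X)`" (Prop. 1.6 p. 34) for every cofinite open `U ⊆ X` of a proper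
`X`, valued in the REAL group `H¹(Π_U, M_X(Ẑ))` with INTRINSIC coefficients
(`cyclotomeModH1 (M.res h) ZHatCoeff`).  INTERFACE (the Kummer map is geometric, [Mzk19] §2).
[cite: MochizukiAbsTopIII2015, Prop 1.6 p.34] -/
structure IntrinsicKummerModel : Type (u + 2) extends DivisorCurveModel.{u} where
  /-- "`κ_U : Γ(U, 𝒪_U^×) → H¹(Π_U, M_X)`" for `U ⊆ X` cofinite open, `X` proper -/
  kummerMap : ∀ {U X : Curve} (h : IsCofiniteOpen U X), IsProper X →
    toDivisorCurveModel.regularUnits U →*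
      Multiplicative (cyclotomeModH1 (res h) ZHatCoeff.{u})

namespace IntrinsicKummerModel

variable (M : IntrinsicKummerModel.{u})

/-- Restriction of the Kummer class of `f` to a subgroup `D ≤ Π_U` ("`κ_U(f)|_x`", Prop. 1.8 p. 36;
"restricting cohomology classes of `Π_U` to the various `I_x`", Prop. 1.6 (iii) p. 35).
[cite: MochizukiAbsTopIII2015, Prop 1.8 (i) p.36] -/
def kummerRes {U X : M.Curve} (h : M.IsCofiniteOpen U X) (hX : M.IsProper X)
    (D : Subgroup (M.ext U).arith) (f : M.regularUnits U) :=
  cyclotomeModH1Res (M.res h) ZHatCoeff.{u} D (Multiplicative.toAdd (M.kummerMap h hX f))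

/-- **Prop. 1.6 (i), relative to `M`** ("suppose further that `k` is a Kummer-faithful field [...]
(i) The Kummer map `κ_U` is injective", pp. 34–35), for every cofinite open `U ⊆ X` of a proper
scheme-like `X` of genus `≥ 2` (so that `M_X` is the cyclotome of Prop. 1.4 (ii)).  NAMED FACT
relative to `M` (hypothesis `IsKummerFaithful`: TODO(general form), see `KummerFaithful.lean`).
[cite: MochizukiAbsTopIII2015, Prop 1.6 (i) p.34] -/
def Prop_1_6_i (M : IntrinsicKummerModel.{u}) : Prop :=
  ∀ (U X : M.Curve) (h : M.IsCofiniteOpen U X) (hX : M.IsProper X), M.IsScheme U → M.IsScheme X →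
    2 ≤ M.genus X → IsKummerFaithful (M.base U) →
      Function.Injective (M.kummerMap h hX)

/-- **Prop. 1.6 (iii), the part statable without the synchronizations, relative to `M`** ("`U = X ∖ S`,
`S ⊆ X(k)` a finite subset", "`1 → (k^×)^∧ → H¹(Π_U, M_X) → ⊕_{x ∈ S} Ẑ`" by restriction to the
`I_x`, p. 35): when all cusps of `U` are rational, a regular unit has vanishing restriction to EVERY
cuspidal inertia group iff it is constant.  PARTIAL typing (the identification
`Hom(I_x, M_X) ≅ Ẑ` and `(k^×)^∧` are not typed); NAMED FACT relative to `M`.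
[cite: MochizukiAbsTopIII2015, Prop 1.6 (iii) p.35] -/
def Prop_1_6_iii_units (M : IntrinsicKummerModel.{u}) : Prop :=
  ∀ (U X : M.Curve) (h : M.IsCofiniteOpen U X) (hX : M.IsProper X), M.IsScheme U → M.IsScheme X →
    2 ≤ M.genus X → IsKummerFaithful (M.base U) →
      (∀ c : (M.cusps U).Cusp, (M.cusps U).IsRational c) →
        ∀ f : M.regularUnits U,
          (∀ c : (M.cusps U).Cusp, M.kummerRes h hX ((M.cusps U).Icusp c) f = 0) ↔
            M.IsConstantUnit (f : (M.FunctionField U)ˣ)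

/-- **Prop. 1.8 (i) for Kummer classes of units, relative to `M`** ("`η ∈ P_U` is the Kummer class of
a nonconstant NF-rational function if and only if there exist a positive multiple `η†` of `η` and
NF-points `x₁, x₂` [...] such that `η†|_{x₁} = 0`, `η†|_{x₂} ≠ 0`", p. 36), for `η = κ_U(f)`,
`f ∈ Γ(U, 𝒪_U^×)`, with restrictions to the decomposition groups `D_x` of NF-points of the model.
PARTIAL typing (`P_U` needs the natural synchronizations); NAMED FACT relative to `M`.
[cite: MochizukiAbsTopIII2015, Prop 1.8 (i) p.36] -/
def Prop_1_8_i_units (M : IntrinsicKummerModel.{u}) : Prop :=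
  ∀ (U X : M.Curve) (h : M.IsCofiniteOpen U X) (hX : M.IsProper X), M.IsScheme U → M.IsScheme X →
    2 ≤ M.genus X → IsKummerFaithful (M.base U) →
      (∀ c : (M.cusps U).Cusp, (M.cusps U).IsRational c) → M.IsNFCurve U →
        ∀ f : M.regularUnits U,
          (M.IsNFRational U ((f : (M.FunctionField U)ˣ) : M.FunctionField U) ∧
              ¬ M.IsConstantUnit (f : (M.FunctionField U)ˣ)) ↔
            ∃ n : ℕ, 0 < n ∧ ∃ x₁ x₂ : M.Point U, M.IsNFPoint U x₁ ∧ M.IsNFPoint U x₂ ∧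
              n • M.kummerRes h hX (M.decomp U x₁) f = 0 ∧
                n • M.kummerRes h hX (M.decomp U x₂) f ≠ 0

/-- **Prop. 1.8 (ii) for Kummer classes of constants, relative to `M`** ("Suppose that there exist
nonconstant NF-rational functions `∈ Γ(U, 𝒪_U^×)`. Then a class `η ∈ P_U ∩ H¹(G_k, M_X)` is the Kummer
class of an NF-constant `∈ k^×` if and only if there exist a nonconstant NF-rational function
`f ∈ Γ(U, 𝒪_U^×)` and an NF-point `x` [...] such that `κ_U(f)|_x = η|_{G_{k_x}}`", p. 36), for
`η = κ_U(c)`, `c ∈ k^×` a constant regular unit.  PARTIAL typing; NAMED FACT relative to `M`.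
[cite: MochizukiAbsTopIII2015, Prop 1.8 (ii) p.36] -/
def Prop_1_8_ii_units (M : IntrinsicKummerModel.{u}) : Prop :=
  ∀ (U X : M.Curve) (h : M.IsCofiniteOpen U X) (hX : M.IsProper X), M.IsScheme U → M.IsScheme X →
    2 ≤ M.genus X → IsKummerFaithful (M.base U) →
      (∀ c : (M.cusps U).Cusp, (M.cusps U).IsRational c) → M.IsNFCurve U →
        (∃ g : M.regularUnits U,
            M.IsNFRational U ((g : (M.FunctionField U)ˣ) : M.FunctionField U) ∧
              ¬ M.IsConstantUnit (g : (M.FunctionField U)ˣ)) →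
          ∀ (c : (M.base U)ˣ)
            (hc : Units.map (algebraMap (M.base U) (M.FunctionField U) : _ →* _) c ∈
              M.regularUnits U),
            M.IsNFConstant U (c : M.base U) ↔
              ∃ (f : M.regularUnits U) (y : M.Point U),
                M.IsNFRational U ((f : (M.FunctionField U)ˣ) : M.FunctionField U) ∧
                  ¬ M.IsConstantUnit (f : (M.FunctionField U)ˣ) ∧ M.IsNFPoint U y ∧
                    M.kummerRes h hX (M.decomp U y) f = M.kummerRes h hX (M.decomp U y) ⟨_, hc⟩

end IntrinsicKummerModel

end Literature.AnabelianGeometry.AbsoluteAnabelian.AbsTopIII
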